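/-
Copyright (c) 2026. All rights reserved.
Released under Apache 2.0 license as described in the file LICENSE.
Authors: abc-iut cell, campaign-S prover seat abc-iut-S1 (wave 1).
-/
import Mathlib.Analysis.SpecialFunctions.Pow.Real
import Mathlib.Analysis.SpecialFunctions.Log.Basic
import Mathlib.Analysis.Normed.Module.Basic
import Mathlib.NumberTheory.Padics.PadicNumbers
import Mathlib.FieldTheory.Finite.Basic
import Mathlib.Algebra.CharP.Basic
import Literature.NumberTheory.GaloisRepresentations.UniformizerResidueIndex
import HarnessLib

/-!
# The invariants `e`, `f` of a mixed-characteristic local field and the ideals `p^λ · R` ([IUTchIV] §1)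

Mochizuki, *Inter-universal Teichmüller theory IV*, RIMS manuscript (Apr. 2020), §1, kurims pp. 9–13
(notation of Propositions 1.1, 1.2, 1.4).  For a finite extension `k ⊆ ℚ̄_p` of `ℚ_p` with ring of
integers `R = 𝒪_k` the text uses: "`ord : ℚ̄_p^× → ℚ` the natural `p`-adic valuation normalized so
that `ord(p) = 1`" (p. 9); "`e_i` for the ramification index of `k_i` over `ℚ_p`;
`a_i := (1/e_i)·⌈e_i/(p−2)⌉` if `p > 2`, `a_i := 2` if `p = 2`; `b_i := ⌊log(p·e_i/(p−1))/log(p)⌋ − 1/e_i`.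
Thus, if `p > 2` and `e_i ≤ p−2`, then `a_i = 1/e_i = −b_i`" (Prop. 1.2, p. 10); "for
`λ ∈ (1/e_i)·ℤ`, we shall write `p^λ · R_i` for the fractional ideal of `R_i` generated by any element
`p^λ` of `k_i` such that `ord(p^λ) = λ`" (p. 10); "`p^{f_i}` for the cardinality of the residue field of
`k_i`" (Prop. 1.4, p. 13).

## Setting and contents (all PROVED; no named fact)

As in the tree's `NormUniformizer.lean` / `UniformizerModulus.lean` and the cell's `LocalUnitLog.lean`:
`K` is a nontrivially normed field, a normed `ℚ_p`-algebra (`‖p‖ = p⁻¹`, i.e. the norm IS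
`p^{-ord(−)}`), ultrametric and proper (= locally compact).  Then (`Ultrametric.exists_isUniformizer`)
`K` has a norm uniformizer `ϖ` and the norm group of `K^×` is `‖ϖ‖^ℤ`.

* `absRamificationIdx p K = e`: the integer with `‖p‖ = ‖ϖ‖^e` for a (every:
  `norm_prime_eq_norm_pow`) uniformizer `ϖ`; `0 < e`; `‖ϖ‖ = p^{-1/e}` (`norm_eq_rpow_of_isUniformizer`);
  the value group is `p^{(1/e)ℤ}` (`exists_norm_eq_rpow`); `‖x‖ < 1 ⇒ ‖x‖ ≤ p^{-1/e}`
  (`norm_le_rpow_of_norm_lt_one`) — "the natural `p`-adic valuation" takes values in `(1/e)ℤ` on `k^×`.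
* `pBall p K λ = p^λ · R = {x : ‖x‖ ≤ p^{-λ}}` for real `λ`; for `λ ∈ (1/e)ℤ` it is the fractional ideal
  `g · R` generated by an element `g` of norm `p^{-λ}` (`exists_norm_eq_rpow_neg`, `pBall_eq_smul`).
* `residueDegree p K = f` with `#(𝒪/𝔪) = p^f` (`card_residueField`), `0 < f`.
* `logRadiusA p e = a`, `logRadiusB p e = b` as printed, with "if `p > 2` and `e ≤ p − 2` then
  `a = 1/e = −b`" (`logRadiusA_eq`, `logRadiusB_eq`).

The different `d_i` (Prop. 1.1) and the log-volume (Prop. 1.4) are separate files.  Nothing here is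
disputed mathematics (Serre, *Local Fields*, Ch. I–II); the [IUTchIV] locators record the cell's typing
of that text, hence the tag form [claim: Mochizuki2012, status: disputed] on the transcribed notation.
-/

noncomputable section

open Metric Set IsLocalRing
open scoped Pointwise

namespace Literature.IUT.LogVolume

open Literature.NumberTheory.GaloisRepresentations.Ultrametric

variable (p : ℕ) [Fact p.Prime]
variable (K : Type*) [NontriviallyNormedField K] [instK : NormedAlgebra ℚ_[p] K]

/-! ## `‖p‖ = p⁻¹` -/

/-- In a normed `ℚ_p`-algebra the norm of a natural number is its `p`-adic norm.
[claim: Mochizuki2012, status: disputed] -/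
theorem norm_natCast_eq_padicNorm (n : ℕ) : ‖(n : K)‖ = ‖(n : ℚ_[p])‖ := by
  rw [← map_natCast (algebraMap ℚ_[p] K) n, norm_algebraMap']

/-- "`ord` … normalized so that `ord(p) = 1`" ([IUTchIV] Prop. 1.1, p. 9): `‖p‖ = p⁻¹` in `K`.
[claim: Mochizuki2012, status: disputed] -/
theorem norm_prime : ‖(p : K)‖ = (p : ℝ)⁻¹ := by
  rw [norm_natCast_eq_padicNorm p K p, Padic.norm_p]

/-- `‖p‖ < 1` in `K`. [claim: Mochizuki2012, status: disputed] -/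
theorem norm_prime_lt_one : ‖(p : K)‖ < 1 := by
  rw [norm_prime p K]
  exact inv_lt_one_of_one_lt₀ (by exact_mod_cast (Fact.out : p.Prime).one_lt)

/-- `(p : K) ≠ 0`. [claim: Mochizuki2012, status: disputed] -/
theorem prime_ne_zero : (p : K) ≠ 0 := by
  intro h
  have := norm_prime p K
  rw [h, norm_zero] at this
  exact (inv_pos.mpr (by exact_mod_cast (Fact.out : p.Prime).pos : (0 : ℝ) < p)).ne' this.symm

/-- `p` as a unit of `K`. [claim: Mochizuki2012, status: disputed] -/
def primeUnit : Kˣ := Units.mk0 (p : K) (prime_ne_zero p K)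

/-- The underlying element of `primeUnit p K` is `p`. [claim: Mochizuki2012, status: disputed] -/
@[simp] theorem coe_primeUnit : ((primeUnit p K : Kˣ) : K) = p := rfl

/-! ## The absolute ramification index `e` -/

section RamIdx

variable [IsUltrametricDist K] [ProperSpace K]

omit instK [IsUltrametricDist K] [ProperSpace K] in
/-- Two norm uniformizers have the same norm (`‖ϖ'‖ = ‖ϖ‖ᵏ`, `‖ϖ‖ = ‖ϖ'‖^{k'}` with `k, k' ≥ 1` force
`k = k' = 1`). [claim: Mochizuki2012, status: disputed] -/
theorem norm_eq_norm_of_isUniformizer {ϖ ϖ' : Kˣ} (h : IsUniformizer ϖ) (h' : IsUniformizer ϖ') :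
    ‖(ϖ : K)‖ = ‖(ϖ' : K)‖ := by
  obtain ⟨k, hk⟩ := h.2 ϖ'
  obtain ⟨k', hk'⟩ := h'.2 ϖ
  have h0 : 0 < ‖(ϖ : K)‖ := norm_units_pos ϖ
  have h0' : 0 < ‖(ϖ' : K)‖ := norm_units_pos ϖ'
  have hk1 : 0 < k := (zpow_lt_one_iff_right_of_lt_one₀ h0 h.1).mp (hk ▸ h'.1)
  have hk'1 : 0 < k' := (zpow_lt_one_iff_right_of_lt_one₀ h0' h'.1).mp (hk' ▸ h.1)
  have hkk : ‖(ϖ : K)‖ = ‖(ϖ : K)‖ ^ (k * k') := by rw [zpow_mul, ← hk, ← hk']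
  have hinj := zpow_right_injective₀ h0 h.1.ne (hkk.symm.trans (zpow_one _).symm)
  have hk_one : k = 1 := Int.eq_one_of_mul_eq_one_right hk1.le hinj
  rw [hk, hk_one, zpow_one]

/-- A chosen norm uniformizer of `K` (they exist: `Ultrametric.exists_isUniformizer`; every statement
below holds for every uniformizer). [claim: Mochizuki2012, status: disputed] -/
def unifChoice : Kˣ := (exists_isUniformizer (F := K)).choose

omit instK in
/-- `unifChoice K` is a norm uniformizer. [claim: Mochizuki2012, status: disputed] -/
theorem isUniformizer_unifChoice : IsUniformizer (unifChoice K) :=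
  (exists_isUniformizer (F := K)).choose_spec

/-- **The (absolute) ramification index `e` of `K` over `ℚ_p`** ("`e_i` the ramification index of `k_i`
over `ℚ_p`", [IUTchIV] Prop. 1.2, p. 10): the integer `e` with `‖p‖ = ‖ϖ‖^e`, i.e. `ord_K(p) = e`, for a
uniformizer `ϖ` (computed with `unifChoice K`; independent of the choice, `norm_prime_eq_norm_pow`).
[claim: Mochizuki2012, status: disputed] -/
def absRamificationIdx : ℕ := ((isUniformizer_unifChoice K).ordFun (primeUnit p K)).toNat

/-- `ord_ϖ(p) ≥ 1` for the chosen uniformizer (since `‖p‖ < 1`). [claim: Mochizuki2012, status: disputed] -/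
theorem ordFun_primeUnit_pos : 0 < (isUniformizer_unifChoice K).ordFun (primeUnit p K) := by
  have h := (isUniformizer_unifChoice K).norm_eq_zpow_ordFun (primeUnit p K)
  rw [coe_primeUnit] at h
  exact (zpow_lt_one_iff_right_of_lt_one₀ (norm_units_pos _) (isUniformizer_unifChoice K).1).mp
    (h ▸ norm_prime_lt_one p K)

/-- **`e ≥ 1`.** [claim: Mochizuki2012, status: disputed] -/
theorem absRamificationIdx_pos : 0 < absRamificationIdx p K := by
  unfold absRamificationIdx
  have := ordFun_primeUnit_pos p K
  omega

/-- **`‖p‖ = ‖ϖ‖^e` for every norm uniformizer `ϖ`** (`ord_K(p) = e`).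
[claim: Mochizuki2012, status: disputed] -/
theorem norm_prime_eq_norm_pow {ϖ : Kˣ} (hϖ : IsUniformizer ϖ) :
    ‖(p : K)‖ = ‖(ϖ : K)‖ ^ absRamificationIdx p K := by
  rw [← norm_eq_norm_of_isUniformizer K (isUniformizer_unifChoice K) hϖ]
  have h := (isUniformizer_unifChoice K).norm_eq_zpow_ordFun (primeUnit p K)
  rw [coe_primeUnit] at h
  rw [h, absRamificationIdx, ← zpow_natCast, Int.toNat_of_nonneg (ordFun_primeUnit_pos p K).le]

/-- `‖ϖ‖^e = p⁻¹`. [claim: Mochizuki2012, status: disputed] -/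
theorem norm_pow_absRamificationIdx {ϖ : Kˣ} (hϖ : IsUniformizer ϖ) :
    ‖(ϖ : K)‖ ^ absRamificationIdx p K = (p : ℝ)⁻¹ := by
  rw [← norm_prime_eq_norm_pow p K hϖ, norm_prime]

/-- **`‖ϖ‖ = p^{-1/e}`** for every norm uniformizer: `ord(ϖ) = 1/e`.
[claim: Mochizuki2012, status: disputed] -/
theorem norm_eq_rpow_of_isUniformizer {ϖ : Kˣ} (hϖ : IsUniformizer ϖ) :
    ‖(ϖ : K)‖ = (p : ℝ) ^ (-(1 / (absRamificationIdx p K : ℝ))) := by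
  have he : absRamificationIdx p K ≠ 0 := (absRamificationIdx_pos p K).ne'
  have hp0 : (0 : ℝ) ≤ p := by positivity
  have h := norm_pow_absRamificationIdx p K hϖ
  calc ‖(ϖ : K)‖ = (‖(ϖ : K)‖ ^ absRamificationIdx p K) ^ ((absRamificationIdx p K : ℝ)⁻¹) :=
        (Real.pow_rpow_inv_natCast (norm_nonneg _) he).symm
    _ = ((p : ℝ) ^ (-1 : ℝ)) ^ ((absRamificationIdx p K : ℝ)⁻¹) := by
        rw [h, Real.rpow_neg_one]
    _ = (p : ℝ) ^ (-(1 / (absRamificationIdx p K : ℝ))) := by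
        rw [← Real.rpow_mul hp0]
        congr 1
        ring

/-- **The value group of `K^×` is `p^{(1/e)ℤ}`**: every `x ≠ 0` has `‖x‖ = p^{-m/e}` for some `m ∈ ℤ`
(`ord(x) = m/e ∈ (1/e)ℤ`). [claim: Mochizuki2012, status: disputed] -/
theorem exists_norm_eq_rpow {x : K} (hx : x ≠ 0) :
    ∃ m : ℤ, ‖x‖ = (p : ℝ) ^ (-(m / (absRamificationIdx p K : ℝ))) := by
  obtain ⟨ϖ, hϖ⟩ := exists_isUniformizer (F := K)
  obtain ⟨m, hm⟩ := hϖ.2 (Units.mk0 x hx)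
  refine ⟨m, ?_⟩
  rw [Units.val_mk0] at hm
  rw [hm, norm_eq_rpow_of_isUniformizer p K hϖ, ← Real.rpow_intCast,
    ← Real.rpow_mul (by positivity : (0 : ℝ) ≤ p)]
  congr 1
  ring

/-- **Discreteness**: `‖x‖ < 1 ⇒ ‖x‖ ≤ p^{-1/e}` (`ord(x) > 0 ⇒ ord(x) ≥ 1/e`).
[claim: Mochizuki2012, status: disputed] -/
theorem norm_le_rpow_of_norm_lt_one {x : K} (hx : ‖x‖ < 1) :
    ‖x‖ ≤ (p : ℝ) ^ (-(1 / (absRamificationIdx p K : ℝ))) := by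
  obtain ⟨ϖ, hϖ⟩ := exists_isUniformizer (F := K)
  rw [← norm_eq_rpow_of_isUniformizer p K hϖ]
  exact hϖ.norm_le_of_norm_lt_one x hx

/-- **`p^λ ∈ K` for `λ ∈ (1/e)ℤ`**: there is an element of norm `p^{-λ}` (namely `ϖ^m`, `λ = m/e`) —
"any element `p^λ` of `k_i` such that `ord(p^λ) = λ`" ([IUTchIV] p. 10).
[claim: Mochizuki2012, status: disputed] -/
theorem exists_norm_eq_rpow_neg (m : ℤ) :
    ∃ g : Kˣ, ‖(g : K)‖ = (p : ℝ) ^ (-(m / (absRamificationIdx p K : ℝ))) := by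
  obtain ⟨ϖ, hϖ⟩ := exists_isUniformizer (F := K)
  refine ⟨ϖ ^ m, ?_⟩
  rw [Units.val_zpow_eq_zpow_val, norm_zpow, norm_eq_rpow_of_isUniformizer p K hϖ,
    ← Real.rpow_intCast, ← Real.rpow_mul (by positivity : (0 : ℝ) ≤ p)]
  congr 1
  ring

end RamIdx

/-! ## The fractional ideals `p^λ · R` -/

/-- **`p^λ · R`** ([IUTchIV] Prop. 1.2, p. 10): `{x ∈ K : ord(x) ≥ λ} = {‖x‖ ≤ p^{-λ}}`, for any real
`λ` (`λ = 0`: `R = 𝒪_K` itself; for `λ ∈ (1/e)ℤ` this is the fractional ideal generated by an element of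
`ord = λ`, `pBall_eq_smul_closedBall`). [claim: Mochizuki2012, status: disputed] -/
def pBall (lam : ℝ) : Set K := {x : K | ‖x‖ ≤ (p : ℝ) ^ (-lam)}

omit [Fact p.Prime] instK in
/-- Membership in `p^λ · R`. [claim: Mochizuki2012, status: disputed] -/
theorem mem_pBall_iff {lam : ℝ} {x : K} : x ∈ pBall p K lam ↔ ‖x‖ ≤ (p : ℝ) ^ (-lam) := Iff.rfl

omit [Fact p.Prime] instK in
/-- `p^λ · R` is the closed ball of radius `p^{-λ}`. [claim: Mochizuki2012, status: disputed] -/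
theorem pBall_eq_closedBall (lam : ℝ) : pBall p K lam = closedBall (0 : K) ((p : ℝ) ^ (-lam)) := by
  ext x
  rw [mem_pBall_iff, mem_closedBall_zero_iff]

omit [Fact p.Prime] instK in
/-- `p^0 · R = R = {‖x‖ ≤ 1}`. [claim: Mochizuki2012, status: disputed] -/
theorem pBall_zero : pBall p K 0 = closedBall (0 : K) 1 := by
  rw [pBall_eq_closedBall, neg_zero, Real.rpow_zero]

omit instK in
/-- `p^λ · R` decreases in `λ`. [claim: Mochizuki2012, status: disputed] -/
theorem pBall_antitone {lam mu : ℝ} (h : lam ≤ mu) : pBall p K mu ⊆ pBall p K lam := by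
  intro x hx
  rw [mem_pBall_iff] at hx ⊢
  refine hx.trans (Real.rpow_le_rpow_of_exponent_le ?_ (neg_le_neg h))
  exact_mod_cast (Fact.out : p.Prime).one_lt.le

omit [Fact p.Prime] instK in
/-- For a unit `g` of norm `p^{-λ}`: `p^λ · R = g · R` ("the fractional ideal of `R_i` generated by any
element `p^λ`"). [claim: Mochizuki2012, status: disputed] -/
theorem pBall_eq_smul_closedBall {lam : ℝ} {g : Kˣ} (hg : ‖(g : K)‖ = (p : ℝ) ^ (-lam)) :
    pBall p K lam = g • closedBall (0 : K) 1 := by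
  rw [units_smul_unitBall, hg, pBall_eq_closedBall]

/-- In particular, for `λ = m/e ∈ (1/e)ℤ` the set `p^λ · R` IS a principal fractional ideal `g · R` with
`‖g‖ = p^{-λ}`. [claim: Mochizuki2012, status: disputed] -/
theorem exists_pBall_eq_smul [IsUltrametricDist K] [ProperSpace K] (m : ℤ) :
    ∃ g : Kˣ, ‖(g : K)‖ = (p : ℝ) ^ (-(m / (absRamificationIdx p K : ℝ))) ∧
      pBall p K (m / (absRamificationIdx p K : ℝ)) = g • closedBall (0 : K) 1 := by
  obtain ⟨g, hg⟩ := exists_norm_eq_rpow_neg p K m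
  exact ⟨g, hg, pBall_eq_smul_closedBall p K hg⟩

/-! ## The residue degree `f` -/

section Residue

open scoped NormedField

variable [IsUltrametricDist K]

/-- `p ∈ 𝔪`: the class of `p` in the residue field `𝒪/𝔪` vanishes (`‖p‖ < 1`).
[claim: Mochizuki2012, status: disputed] -/
theorem residue_natCast_prime_eq_zero :
    (p : ResidueField (Valued.integer K)) = 0 := by
  rw [← map_natCast (residue (Valued.integer K)), residue_eq_zero_iff,
    mem_maximalIdeal_iff_norm_lt_one]
  change ‖((p : Valued.integer K) : K)‖ < 1
  rw [SubringClass.coe_natCast]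
  exact norm_prime_lt_one p K

/-- The residue field `𝒪/𝔪` has characteristic `p`. [claim: Mochizuki2012, status: disputed] -/
theorem charP_residueField : CharP (ResidueField (Valued.integer K)) p :=
  (CharP.charP_iff_prime_eq_zero Fact.out).mpr (residue_natCast_prime_eq_zero p K)

/-- **The residue degree `f` of `K` over `ℚ_p`** ("`p^{f_i}` for the cardinality of the residue field of
`k_i`", [IUTchIV] Prop. 1.4, p. 13): `f := log_p #(𝒪/𝔪)` (`card_residueField`: `#(𝒪/𝔪) = p^f`).
[claim: Mochizuki2012, status: disputed] -/
def residueDegree : ℕ := Nat.log p (Nat.card (ResidueField (Valued.integer K)))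

/-- **`#(𝒪/𝔪) = p^f`.** [claim: Mochizuki2012, status: disputed] -/
theorem card_residueField [ProperSpace K] :
    Nat.card (ResidueField (Valued.integer K)) = p ^ residueDegree p K := by
  haveI : Finite (ResidueField (Valued.integer K)) := finite_residueField
  letI : Fintype (ResidueField (Valued.integer K)) := Fintype.ofFinite _
  haveI := charP_residueField p K
  obtain ⟨n, -, hn⟩ := FiniteField.card (ResidueField (Valued.integer K)) p
  rw [residueDegree, Nat.card_eq_fintype_card, hn, Nat.log_pow (Fact.out : p.Prime).one_lt]

/-- **`f ≥ 1`.** [claim: Mochizuki2012, status: disputed] -/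
theorem residueDegree_pos [ProperSpace K] : 0 < residueDegree p K := by
  have h2 : 2 ≤ Nat.card (ResidueField (Valued.integer K)) := by
    obtain ⟨ϖ, hϖ⟩ := exists_isUniformizer (F := K)
    exact hϖ.two_le_card_residueField
  rw [card_residueField p K] at h2
  by_contra h0
  rw [not_lt, Nat.le_zero] at h0
  rw [h0, pow_zero] at h2
  omega

end Residue

/-! ## The exponents `a`, `b` of [IUTchIV] Proposition 1.2 -/

/-- **`a := (1/e)·⌈e/(p−2)⌉` if `p > 2`, `a := 2` if `p = 2`** ([IUTchIV] Prop. 1.2, p. 10), as a function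
of the prime `p` and the ramification index `e`. [claim: Mochizuki2012, status: disputed] -/
def logRadiusA (p e : ℕ) : ℝ := if p = 2 then 2 else (⌈(e : ℝ) / ((p : ℝ) - 2)⌉ : ℝ) / e

/-- **`b := ⌊log(p·e/(p−1))/log(p)⌋ − 1/e`** ([IUTchIV] Prop. 1.2, p. 10), as a function of `p` and `e`
("`log`" the natural logarithm, p. 9). [claim: Mochizuki2012, status: disputed] -/
def logRadiusB (p e : ℕ) : ℝ :=
  (⌊Real.log ((p : ℝ) * e / ((p : ℝ) - 1)) / Real.log p⌋ : ℝ) - 1 / e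

omit instK in
/-- "Thus, if `p > 2` and `e ≤ p−2`, then `a = 1/e`" (Prop. 1.2, p. 10): `⌈e/(p−2)⌉ = 1`.
[claim: Mochizuki2012, status: disputed] -/
theorem logRadiusA_eq {p e : ℕ} (hp : 2 < p) (he₁ : 1 ≤ e) (he : e ≤ p - 2) :
    logRadiusA p e = 1 / e := by
  have hp2 : (0 : ℝ) < (p : ℝ) - 2 := by
    have : (2 : ℝ) < p := by exact_mod_cast hp
    linarith
  have hceil : ⌈(e : ℝ) / ((p : ℝ) - 2)⌉ = 1 := by
    rw [Int.ceil_eq_iff]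
    constructor
    · simp only [Int.cast_one, sub_self]
      exact div_pos (by exact_mod_cast he₁) hp2
    · rw [Int.cast_one, div_le_one hp2]
      have : (e : ℝ) ≤ ((p - 2 : ℕ) : ℝ) := by exact_mod_cast he
      rw [Nat.cast_sub hp.le] at this
      simpa using this
  rw [logRadiusA, if_neg (by omega), hceil, Int.cast_one]

omit instK in
/-- "… `= −b`" (Prop. 1.2, p. 10): for `p > 2` and `1 ≤ e ≤ p − 2`, `1 ≤ p·e/(p−1) < p`, so the floor
vanishes and `b = −1/e`. [claim: Mochizuki2012, status: disputed] -/
theorem logRadiusB_eq {p e : ℕ} (hp : 2 < p) (he₁ : 1 ≤ e) (he : e ≤ p - 2) :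
    logRadiusB p e = -(1 / e) := by
  have hp1 : (1 : ℝ) < p := by exact_mod_cast (show 1 < p by omega)
  have hp1' : (0 : ℝ) < (p : ℝ) - 1 := by linarith
  have he' : (1 : ℝ) ≤ e := by exact_mod_cast he₁
  have hlt : (e : ℝ) < (p : ℝ) - 1 := by
    have : (e : ℝ) ≤ ((p - 2 : ℕ) : ℝ) := by exact_mod_cast he
    rw [Nat.cast_sub hp.le] at this
    push_cast at this
    linarith
  set x : ℝ := (p : ℝ) * e / ((p : ℝ) - 1) with hx
  have hx1 : 1 ≤ x := by
    rw [hx, le_div_iff₀ hp1']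
    nlinarith
  have hxp : x < p := by
    rw [hx, div_lt_iff₀ hp1']
    nlinarith
  have hlogp : 0 < Real.log p := Real.log_pos hp1
  have hfloor : ⌊Real.log x / Real.log p⌋ = 0 := by
    rw [Int.floor_eq_iff]
    constructor
    · simp only [Int.cast_zero]
      exact div_nonneg (Real.log_nonneg hx1) hlogp.le
    · rw [Int.cast_zero, zero_add, div_lt_one hlogp]
      exact Real.log_lt_log (by linarith) hxp
  rw [logRadiusB, ← hx, hfloor, Int.cast_zero, zero_sub]

end Literature.IUT.LogVolume

end
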